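import Literature.MathematicalPhysics.QuantumManyBody.PeriodicBoseGasFracEnergy
import Literature.MathematicalPhysics.QuantumManyBody.BoseGasFreeDirichletBEC
import HarnessLib

/-!
# The free sub-cell gap inequality on the cellN carrier (`CellNKeyInequality`, P4 engine of
# stmt-AtomisticToContinuum-13595 `BlockCondensation`)

decomp-a2c · hand-2 g8 · cell service for lens-6 g28 (`CARRIER-CHANGE-13595-P1.md` §4, critic rows
394 (3) / 397 (1)(a)).  The tree's `key_inequality` (`BoseGasFreeDirichletBEC.lean`) is stated for a
DIRICHLET state `Ψ : TrialState (n+1) L` (support in the open box).  Here the same inequality is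
proved for the boundary-condition-free carrier of the `BlockCondensation` leaf: a `C¹`,
Bose-symmetric `ψ : Config (n+1) → ℂ` normalised on the fundamental cell `[0,L)^{3(n+1)}`,
`L = kℓ`, with the kinetic energy and the sub-cell occupations taken ON THE CELL:

`(π/ℓ)² (n+1) ≤ ∫_{cellN} |∇ψ|² + (π/ℓ)² ∑_q ⟨u_q, γ_{1_{cellN} ψ} u_q⟩`,

`u_q = ℓ^{-3/2} 1_{Q_q}` the constant modes of the `k³` sub-cells `Q_q = ℓq + [0,ℓ)³`.  No boundary
condition is used: the sharp Poincaré inequality (`local_poincare_cellShift`, Neumann gap `π²/ℓ²`)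
is applied per sub-cell to each slice `x ↦ ψ(x, Y)` on `[0,L)³ = ⋃_q Q_q`, integrated over
`Y ∈ [0,L)^{3n}` (Tonelli `lintegral_cellN_succ`), and multiplied by `n+1` using Bose symmetry on
the cell (`lintegral_cellN_comp_perm`).  The statement `cellN_key_inequality` is, binder for
binder, the body of lens-6's `CellNKeyInequality` (g28 spec `BlockCondensationCellNEngine.lean`),
so `cellNBudgetBlockFloorZero_of_keyInequality cellN_key_inequality` discharges F♭₀ once the spec
lands.  No definitions, no `sorry`.
-/

noncomputable section

namespace Summit.AtomisticToContinuum.BoseEinsteinCondensation.Theorems.BlockLatticeFSumBlockCondensationCellNKeyInequality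

open MeasureTheory
open scoped ENNReal NNReal BigOperators ComplexConjugate
open Literature.MathematicalPhysics.QuantumManyBody.BoseGas

variable {n k : ℕ} {ℓ L : ℝ}

/-- **One slice on the cell**: for `f ∈ C¹(ℝ³)` and `ℓ > 0`,
`(π/ℓ)² ∫_{[0,kℓ)³} |f|² ≤ ∫_{[0,kℓ)³} |∇f|² + (π/ℓ)² ℓ⁻³ ∑_q |∫_{Q_q} f|²` — the localised sharp
Poincaré inequality on each of the `k³` sub-cells, summed over the partition of the big cell.
[cite: LSSY2005, Ch. 5 (5.15)–(5.17)] -/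
theorem slice_key_cell (hℓ : 0 < ℓ) {f : Space → ℂ} (hf : ContDiff ℝ 1 f) :
    ENNReal.ofReal ((Real.pi / ℓ) ^ 2) * ∫⁻ x in cell (k * ℓ), (‖f x‖₊ : ℝ≥0∞) ^ 2 ≤
      (∫⁻ x in cell (k * ℓ), gradSqC f x) +
        ENNReal.ofReal ((Real.pi / ℓ) ^ 2) * ∑ q : SubIdx k,
          (ENNReal.ofReal ℓ ^ 3)⁻¹ * (‖∫ x in subCell ℓ q, f x‖₊ : ℝ≥0∞) ^ 2 := by
  have hnorm : ∫⁻ x in cell (k * ℓ), (‖f x‖₊ : ℝ≥0∞) ^ 2 =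
      ∑ q : SubIdx k, ∫⁻ x in subCell ℓ q, (‖f x‖₊ : ℝ≥0∞) ^ 2 :=
    (sum_setLIntegral_subCell hℓ
      (hf.continuous.measurable.nnnorm.coe_nnreal_ennreal.pow_const 2).aemeasurable).symm
  have hgrad : ∑ q : SubIdx k, ∫⁻ x in subCell ℓ q, gradSqC f x = ∫⁻ x in cell (k * ℓ), gradSqC f x :=
    sum_setLIntegral_subCell hℓ (measurable_gradSqC_any f).aemeasurable
  have hloc : ∀ q : SubIdx k,
      ENNReal.ofReal ((Real.pi / ℓ) ^ 2) * ∫⁻ x in subCell ℓ q, (‖f x‖₊ : ℝ≥0∞) ^ 2 ≤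
        (∫⁻ x in subCell ℓ q, gradSqC f x) + ENNReal.ofReal ((Real.pi / ℓ) ^ 2) *
          ((ENNReal.ofReal ℓ ^ 3)⁻¹ * (‖∫ x in subCell ℓ q, f x‖₊ : ℝ≥0∞) ^ 2) :=
    fun q => local_poincare_cellShift hℓ hf (subOffset ℓ q)
  calc ENNReal.ofReal ((Real.pi / ℓ) ^ 2) * ∫⁻ x in cell (k * ℓ), (‖f x‖₊ : ℝ≥0∞) ^ 2
      = ∑ q : SubIdx k, ENNReal.ofReal ((Real.pi / ℓ) ^ 2) *
          ∫⁻ x in subCell ℓ q, (‖f x‖₊ : ℝ≥0∞) ^ 2 := by rw [hnorm, Finset.mul_sum]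
    _ ≤ ∑ q : SubIdx k, ((∫⁻ x in subCell ℓ q, gradSqC f x) + ENNReal.ofReal ((Real.pi / ℓ) ^ 2) *
          ((ENNReal.ofReal ℓ ^ 3)⁻¹ * (‖∫ x in subCell ℓ q, f x‖₊ : ℝ≥0∞) ^ 2)) :=
        Finset.sum_le_sum fun q _ => hloc q
    _ = (∑ q : SubIdx k, ∫⁻ x in subCell ℓ q, gradSqC f x) + ENNReal.ofReal ((Real.pi / ℓ) ^ 2) *
          ∑ q : SubIdx k, (ENNReal.ofReal ℓ ^ 3)⁻¹ * (‖∫ x in subCell ℓ q, f x‖₊ : ℝ≥0∞) ^ 2 := by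
        rw [Finset.sum_add_distrib, Finset.mul_sum]
    _ = _ := by rw [hgrad]

/-- A sub-cell mode is supported in the big cell: `1_{[0,kℓ)³} u_q = u_q` (`ℓ > 0`). [folklore] -/
theorem indicator_cell_subMode (hℓ : 0 < ℓ) (q : SubIdx k) :
    (cell (k * ℓ)).indicator (subMode ℓ q) = subMode ℓ q := by
  funext x
  by_cases hx : x ∈ cell (k * ℓ)
  · exact Set.indicator_of_mem hx _
  · rw [Set.indicator_of_notMem hx, subMode_eq_indicator,
      Set.indicator_of_notMem (fun h => hx (subCell_subset_cell hℓ q h))]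

/-- **Occupation of a sub-cell mode in the cell-restricted state, through slices**:
`⟨u_q, γ_{1_{cellN} ψ} u_q⟩ = (n+1) ∫_{[0,L)^{3n}} ℓ⁻³ |∫_{Q_q} ψ(x, Y) dx|² dY` for `L = kℓ`
(the spectator variables run over the cell only; the sub-cell lies in the cell).
[cite: LSSY2005, §1.2 (1.17)] -/
theorem occupation_subMode_indicator (hℓ : 0 < ℓ) (hkℓ : (k : ℝ) * ℓ = L) (q : SubIdx k)
    (ψ : Config (n + 1) → ℂ) :
    occupation (n + 1) (subMode ℓ q) ((cellN (n + 1) L).indicator ψ) =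
      (n + 1 : ℝ≥0∞) * ∫⁻ Y in cellN n L, (ENNReal.ofReal ℓ ^ 3)⁻¹ *
        (‖∫ x in subCell ℓ q, ψ (Matrix.vecCons x Y)‖₊ : ℝ≥0∞) ^ 2 := by
  have hocc : occupation (n + 1) (subMode ℓ q) ((cellN (n + 1) L).indicator ψ) =
      cellOccupation (n + 1) L (subMode ℓ q) ψ := by
    rw [cellOccupation, ← hkℓ, indicator_cell_subMode hℓ q, hkℓ]
  rw [hocc, cellOccupation_succ]
  congr 1
  refine lintegral_congr fun Y => ?_
  -- the slice pairing on the cell is the pairing on the whole space (support in `Q_q ⊆ cell`)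
  have hsub : subCell ℓ q ⊆ cell L := hkℓ ▸ subCell_subset_cell hℓ q
  have hint : ∫ x in cell L, conj (subMode ℓ q x) * ψ (Matrix.vecCons x Y) =
      ∫ x, conj (subMode ℓ q x) * ψ (Matrix.vecCons x Y) := by
    refine setIntegral_eq_integral_of_forall_compl_eq_zero fun x hx => ?_
    rw [subMode_eq_indicator, Set.indicator_of_notMem (fun h => hx (hsub h)), map_zero, zero_mul]
  rw [hint, integral_conj_subMode_mul, nnnorm_mul, ENNReal.coe_mul, mul_pow, nnnorm_constantMode_sq hℓ]

/-- **Bose symmetry on the cell**: `∫_{cellN} |∇ψ|² = (n+1) ∫_{cellN} |∇₀ψ|²` for a permutation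
symmetric differentiable `ψ`. [folklore] -/
theorem lintegral_cellN_kineticDensity_eq_mul {ψ : Config (n + 1) → ℂ} (hψ : Differentiable ℝ ψ)
    (hsymm : ∀ (σ : Equiv.Perm (Fin (n + 1))) (X : Config (n + 1)), ψ (X ∘ σ) = ψ X) :
    ∫⁻ X in cellN (n + 1) L, kineticDensity ψ X =
      (n + 1 : ℝ≥0∞) * ∫⁻ X in cellN (n + 1) L, partialGradSq 0 ψ X := by
  simp only [kineticDensity_eq_sum_partialGradSq]
  rw [lintegral_finsetSum _ fun i _ => measurable_partialGradSq i ψ]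
  have hi : ∀ i : Fin (n + 1), ∫⁻ X in cellN (n + 1) L, partialGradSq i ψ X =
      ∫⁻ X in cellN (n + 1) L, partialGradSq 0 ψ X := fun i => by
    have h1 : (fun X => partialGradSq i ψ X) = fun X => partialGradSq 0 ψ (X ∘ Equiv.swap 0 i) :=
      funext fun X => partialGradSq_eq_zero_comp_swap hψ hsymm i X
    rw [show (partialGradSq i ψ) = fun X => partialGradSq i ψ X from rfl, h1,
      lintegral_cellN_comp_perm (Equiv.swap 0 i) (fun X => partialGradSq 0 ψ X)]
  simp only [hi, Finset.sum_const, Finset.card_univ, Fintype.card_fin, nsmul_eq_mul]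
  push_cast
  ring

/-- **The key inequality on the cellN carrier** (`CellNKeyInequality` of the lens-6 g28 spec,
binder for binder): for a `C¹`, Bose-symmetric `ψ` normalised on `cellN (n+1) L`, `L = kℓ`,
`(π/ℓ)² (n+1) ≤ ∫_{cellN} |∇ψ|² + (π/ℓ)² ∑_q ⟨u_q, γ_{1_{cellN} ψ} u_q⟩` — every particle is either
kinetically excited at the Neumann sub-cell gap or condensed into a sub-cell constant mode; no
boundary condition enters (the Poincaré inequality is per sub-cell).
[cite: LSSY2005, Ch. 5 (5.15)–(5.17)] -/
theorem cellN_key_inequality :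
    ∀ (n k : ℕ) (ℓ L : ℝ), 0 < ℓ → (k : ℝ) * ℓ = L →
    ∀ (ψ : Config (n + 1) → ℂ), ContDiff ℝ 1 ψ →
      (∀ (σ : Equiv.Perm (Fin (n + 1))) (X : Config (n + 1)), ψ (X ∘ σ) = ψ X) →
      ∫⁻ X in cellN (n + 1) L, (‖ψ X‖₊ : ℝ≥0∞) ^ 2 = 1 →
      ENNReal.ofReal ((Real.pi / ℓ) ^ 2) * ((n + 1 : ℕ) : ℝ≥0∞) ≤
        (∫⁻ X in cellN (n + 1) L, kineticDensity ψ X) +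
          ENNReal.ofReal ((Real.pi / ℓ) ^ 2) *
            ∑ q : SubIdx k, occupation (n + 1) (subMode ℓ q) ((cellN (n + 1) L).indicator ψ) := by
  intro n k ℓ L hℓ hkℓ ψ hψ hsymm hnorm
  set C := ENNReal.ofReal ((Real.pi / ℓ) ^ 2) with hC
  have hcont : Continuous ψ := hψ.continuous
  have hdiff : Differentiable ℝ ψ := hψ.differentiable one_ne_zero
  -- the slice inequality on the cell, for every `Y`
  have hslice : ∀ Y : Config n,
      C * ∫⁻ x in cell L, (‖ψ (Matrix.vecCons x Y)‖₊ : ℝ≥0∞) ^ 2 ≤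
        (∫⁻ x in cell L, gradSqC (fun y => ψ (Matrix.vecCons y Y)) x) +
          C * ∑ q : SubIdx k, (ENNReal.ofReal ℓ ^ 3)⁻¹ *
            (‖∫ x in subCell ℓ q, ψ (Matrix.vecCons x Y)‖₊ : ℝ≥0∞) ^ 2 := fun Y => by
    have h := slice_key_cell (k := k) hℓ (contDiff_vecCons_slice hψ Y)
    rwa [hkℓ] at h
  -- integrate it over `Y ∈ [0,L)^{3n}`
  have hint := lintegral_mono (μ := (volume : Measure (Config n)).restrict (cellN n L)) hslice
  -- left-hand side: `C · ∫_{cellN} |ψ|² = C`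
  have hF : Measurable fun X : Config (n + 1) => (‖ψ X‖₊ : ℝ≥0∞) ^ 2 :=
    hcont.measurable.nnnorm.coe_nnreal_ennreal.pow_const _
  have hL1 : ∫⁻ Y in cellN n L, C * ∫⁻ x in cell L, (‖ψ (Matrix.vecCons x Y)‖₊ : ℝ≥0∞) ^ 2 = C := by
    rw [lintegral_const_mul' _ _ ENNReal.ofReal_ne_top,
      ← lintegral_cellN_succ L (F := fun X => (‖ψ X‖₊ : ℝ≥0∞) ^ 2) hF, hnorm, mul_one]
  -- right-hand side: Tonelli for the gradient term, linearity for the mode terms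
  have hgradY : ∀ Y : Config n, (∫⁻ x in cell L, gradSqC (fun y => ψ (Matrix.vecCons y Y)) x) =
      ∫⁻ x in cell L, partialGradSq 0 ψ (Matrix.vecCons x Y) := fun Y =>
    lintegral_congr fun x => gradSqC_vecCons_eq_partialGradSq hdiff x Y
  have hA : Measurable fun Y : Config n => ∫⁻ x in cell L, partialGradSq 0 ψ (Matrix.vecCons x Y) := by
    have hG : Measurable fun p : Space × Config n => partialGradSq 0 ψ (Matrix.vecCons p.1 p.2) :=
      (measurable_partialGradSq 0 ψ).comp measurable_vecCons
    exact hG.lintegral_prod_left'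
  have hBq : ∀ q : SubIdx k, Measurable fun Y : Config n =>
      (ENNReal.ofReal ℓ ^ 3)⁻¹ * (‖∫ x in subCell ℓ q, ψ (Matrix.vecCons x Y)‖₊ : ℝ≥0∞) ^ 2 :=
    fun q => (measurable_sliceSetIntegral_sq hcont _).const_mul _
  have hR : ∫⁻ Y in cellN n L, ((∫⁻ x in cell L, gradSqC (fun y => ψ (Matrix.vecCons y Y)) x) +
      C * ∑ q : SubIdx k, (ENNReal.ofReal ℓ ^ 3)⁻¹ *
        (‖∫ x in subCell ℓ q, ψ (Matrix.vecCons x Y)‖₊ : ℝ≥0∞) ^ 2) =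
      (∫⁻ X in cellN (n + 1) L, partialGradSq 0 ψ X) + C * ∑ q : SubIdx k, ∫⁻ Y in cellN n L,
        (ENNReal.ofReal ℓ ^ 3)⁻¹ * (‖∫ x in subCell ℓ q, ψ (Matrix.vecCons x Y)‖₊ : ℝ≥0∞) ^ 2 := by
    simp only [hgradY]
    rw [lintegral_add_left hA, ← lintegral_cellN_succ L (measurable_partialGradSq 0 ψ),
      lintegral_const_mul' _ _ ENNReal.ofReal_ne_top, lintegral_finsetSum _ fun q _ => hBq q]
  rw [hL1, hR] at hint
  -- multiply by `n + 1`
  have hT : (n + 1 : ℝ≥0∞) * ∫⁻ X in cellN (n + 1) L, partialGradSq 0 ψ X =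
      ∫⁻ X in cellN (n + 1) L, kineticDensity ψ X :=
    (lintegral_cellN_kineticDensity_eq_mul hdiff hsymm).symm
  have hocc : ∀ q : SubIdx k, (n + 1 : ℝ≥0∞) * ∫⁻ Y in cellN n L, (ENNReal.ofReal ℓ ^ 3)⁻¹ *
      (‖∫ x in subCell ℓ q, ψ (Matrix.vecCons x Y)‖₊ : ℝ≥0∞) ^ 2 =
      occupation (n + 1) (subMode ℓ q) ((cellN (n + 1) L).indicator ψ) :=
    fun q => (occupation_subMode_indicator hℓ hkℓ q ψ).symm
  have hcast : ((n + 1 : ℕ) : ℝ≥0∞) = (n + 1 : ℝ≥0∞) := by push_cast; rfl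
  calc C * ((n + 1 : ℕ) : ℝ≥0∞) = (n + 1 : ℝ≥0∞) * C := by rw [hcast, mul_comm]
    _ ≤ (n + 1 : ℝ≥0∞) * ((∫⁻ X in cellN (n + 1) L, partialGradSq 0 ψ X) + C * ∑ q : SubIdx k,
        ∫⁻ Y in cellN n L, (ENNReal.ofReal ℓ ^ 3)⁻¹ *
          (‖∫ x in subCell ℓ q, ψ (Matrix.vecCons x Y)‖₊ : ℝ≥0∞) ^ 2) := by
        gcongr
    _ = (∫⁻ X in cellN (n + 1) L, kineticDensity ψ X) +
        C * ∑ q : SubIdx k, occupation (n + 1) (subMode ℓ q) ((cellN (n + 1) L).indicator ψ) := by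
        rw [mul_add, hT, Finset.mul_sum, Finset.mul_sum, Finset.mul_sum]
        congr 1
        refine Finset.sum_congr rfl fun q _ => ?_
        rw [← hocc q]
        ring

end Summit.AtomisticToContinuum.BoseEinsteinCondensation.Theorems.BlockLatticeFSumBlockCondensationCellNKeyInequality

end
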